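import Summits.Ventures.HodgeRepro2.T5RecordSphericalSpectrumIntrinsic
import Summits.Ventures.HodgeRepro2.T5CyclotomicSevenInertThree
import Summits.Ventures.HodgeRepro2.T5CyclotomicSevenNonDyadic
import Summits.Ventures.HodgeRepro2.T5RecordSatakeToy

/-!
# The unramified spectrum of the record's pair on the FIELD OF RECORD `ℚ(ζ₇)` at the inert place `(3)`: `q = 27`

Tier-5 support N3 / §G-N4.2 (seat p3, gen 86). File 344 gives, at every place `v` of `K⁺` that stays prime in the
CM field `K` and is good for the Gram matrix `H`, with `q'` any value equal to `N(v)`: `u₀ ∈ 𝒪_{K⁺_v}ˣ`,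
`Φ : U(J₃(u₀)) ≃* U(1 ⊗ H)` matching the hyperspecial subgroups, a star-fixed uniformiser `ϖ'`, such that every
irreducible `K_v`-finite representation of `U(1 ⊗ H)` with non-zero finite-dimensional `K_v`-invariants is
`≅ (inertSphericalQuot (α q'⁻²)) ∘ Φ⁻¹` for some `α ≠ 0`. File 345 read it on `ℚ(i)` at `(3)`; this file reads it on
the brief's sextic Galois CM field of record `ℚ(ζ₇)` at the place `(3)` of `ℚ(ζ₇)⁺` (file 253's `vThreeSeven`,
which stays prime in `ℚ(ζ₇)` with `N(v) = 27`), with `H₀ = diag(1, 1, −1)` (file 237), so that the Satake parameter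
reads `α · (27²)⁻¹ = α / 729`:

* **`exists_mulEquiv_forall_nonempty_equiv_inertSphericalQuot_record_seven_three`** — for any seventh cyclotomic
  extension `K` of `ℚ`, any datum `(θ, y)` and any generators `l`, with `q' = 27`;
* `neg_seven_eq_sqrtNegSeven_sq`, `complexConj_sqrtNegSeven_ne` — the explicit datum `(θ, y) = (−7, √−7)` of
  `K7 = ℚ(ζ₇)` (`√−7 = 1 + 2(ζ₇ + ζ₇² + ζ₇⁴)`, file 145: `sqrtNegSeven_sq`, `complexConj_sqrtNegSeven`);
* **`…_record_seven_three_K7`** — the statement on p1's `K7 = CyclotomicField 7 ℚ` with the explicit datum;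
* `exists_generators_and_…_K7` — with the generators supplied by file 235: the whole hypothesis set of file 344's
  statement inhabited on the field of record at `3`.

As in file 345 the number-field and CM-field structures of `K` are section instances (`Prop`-valued classes; for
`K7` they are Mathlib's `CyclotomicField.instNumberField` and p1's `isCMField_K7`).

§8(d): uses an L-value-free non-vanishing device: NO.
-/

open Matrix NumberField NumberField.IsCMField IsDedekindDomain IsDedekindDomain.HeightOneSpectrum Module
  MulAction
open scoped TensorProduct Pointwise
open Summit.Ventures.HodgeRepro2.T5UnitaryGroupForm Summit.Ventures.HodgeRepro2.T5UnitaryHeckeAdjoint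
  Summit.Ventures.HodgeRepro2.T5HeckePermutationModule Summit.Ventures.HodgeRepro2.LevelPositivity
  Summit.Ventures.HodgeRepro2.T5LevelIdempotent Summit.Ventures.HodgeRepro2.T5StarOfInvolution
  Summit.Ventures.HodgeRepro2.T5FinitePlaceCM Summit.Ventures.HodgeRepro2.T5NonSplitPlaceUnitaryGroup
  Summit.Ventures.HodgeRepro2.T5RecordHyperspecial Summit.Ventures.HodgeRepro2.T5GlobalLatticeAlmostAll
  Summit.Ventures.HodgeRepro2.T5HermitianThreeElements Summit.Ventures.HodgeRepro2.T5GaloisCartanThree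
  Summit.Ventures.HodgeRepro2.T5InertDegreeGalois Summit.Ventures.HodgeRepro2.T5InertPlaceCompletion
  Summit.Ventures.HodgeRepro2.T5InertDegreeAdicCompletion Summit.Ventures.HodgeRepro2.T5InertSatakeTransform
  Summit.Ventures.HodgeRepro2.T5InertSatakeTransformCompletion Summit.Ventures.HodgeRepro2.T5InertUnipotentResidue
  Summit.Ventures.HodgeRepro2.T5InertSphericalSubquotient Summit.Ventures.HodgeRepro2.T5RecordSatakeCell
  Summit.Ventures.HodgeRepro2.T5SplitPlaceUnitaryGroup Summit.Ventures.HodgeRepro2.T5FinitePlaceNormIndex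
  Summit.Ventures.HodgeRepro2.T5HermitianLocalIsotropyN3 Summit.Ventures.HodgeRepro2.T5FinitePlaceSplitClassification
  Summit.Ventures.HodgeRepro2.T5InertDegreeCompletion Summit.Ventures.HodgeRepro2.T5InertPlaceCompletionCells
  Summit.Ventures.HodgeRepro2.T5RecordSatake Summit.Ventures.HodgeRepro2.T5CartanCellsDistinct
  Summit.Ventures.HodgeRepro2.T5RecordSatakeInert Summit.Ventures.HodgeRepro2.T5InertGlobalPrime
  Summit.Ventures.HodgeRepro2.T5CMFieldSquareDatum Summit.Ventures.HodgeRepro2.T5RecordSatakeDegree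
  Summit.Ventures.HodgeRepro2.T5RecordSatakeDegreeIntrinsic Summit.Ventures.HodgeRepro2.T5RecordSphericalSpectrum
  Summit.Ventures.HodgeRepro2.T5RecordSphericalSpectrumIntrinsic Summit.Ventures.HodgeRepro2.T5RecordSatakeToy
  Summit.Ventures.HodgeRepro2.T5CyclotomicSevenInertThree Summit.Ventures.HodgeRepro2.T5CyclotomicSevenNonDyadic
  Summit.Ventures.HodgeRepro2.CyclotomicSeven

namespace Summit.Ventures.HodgeRepro2.T5RecordSphericalSpectrumSevenToy

universe uV

section Generic

variable (K : Type*) [Field K] [CharZero K] [IsCyclotomicExtension {7} ℚ K] [NumberField K] [IsCMField K]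
variable {θ : maximalRealSubfield K} {y : K}
  (hθ : algebraMap (maximalRealSubfield K) K θ = y ^ 2) (hy : complexConj K y ≠ y)
variable {r : ℕ} (l : Fin r → 𝓞 K) (k : Type*) [Field k] [CharZero k] [IsAlgClosed k]

omit [IsCMField K] [CharZero k] [IsAlgClosed k] in
/-- `N(vThreeSeven) = 27` read in any field `k`. -/
theorem absNorm_vThreeSeven_cast : (Ideal.absNorm (vThreeSeven K).asIdeal : k) = 27 := by
  rw [absNorm_vThreeSeven K]
  norm_num

include hθ hy in
/-- **THE UNRAMIFIED SPECTRUM OF THE RECORD'S PAIR ON `ℚ(ζ₇)` AT THE INERT PLACE `(3)`, `q = 27`** (file 344's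
`exists_mulEquiv_forall_nonempty_equiv_inertSphericalQuot_record_of_staysPrime` with `hmap := map_vThreeSeven`,
`H := H₀ = diag(1, 1, −1)`, `q' = 27`): for any datum `(θ, y)` and any generators `l`: there are `u₀ ∈ 𝒪_{K⁺_v}ˣ`,
`Φ : U(J₃(u₀)) ≃* U(1 ⊗ H₀)` matching the hyperspecial subgroups, and a star-fixed uniformiser `ϖ'` of `𝒪_{K_w}`,
such that every irreducible `K_{(3)}`-finite representation of `U(1 ⊗ H₀)` with non-zero finite-dimensional
`K_{(3)}`-invariants is `≅ (inertSphericalQuot (α · (27²)⁻¹)) ∘ Φ⁻¹` for some `α ≠ 0`. -/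
theorem exists_mulEquiv_forall_nonempty_equiv_inertSphericalQuot_record_seven_three
    (hl : Submodule.span (𝓞 (maximalRealSubfield K)) (Set.range l) = ⊤) :
    letI := tensorStarRing K (vThreeSeven K)
    letI := starRingOfQuadratic (finrank_eq_two K (vThreeSeven K) (wThreeSeven K) hθ hy
        (not_isSquare_of_staysPrime K (vThreeSeven K) (wThreeSeven K) hθ hy (map_vThreeSeven K)))
      (localConj (vThreeSeven K) (wThreeSeven K) hθ.symm (span_pair_eq_top K hy)
        (not_isSquare_of_staysPrime K (vThreeSeven K) (wThreeSeven K) hθ hy (map_vThreeSeven K))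
        (complexConj K))
      (localConj_ne_one (vThreeSeven K) (wThreeSeven K) hθ.symm (span_pair_eq_top K hy)
        (not_isSquare_of_staysPrime K (vThreeSeven K) (wThreeSeven K) hθ hy (map_vThreeSeven K))
        (complexConj K) (complexConj_apply_eq_neg K hθ hy))
    haveI := isDiscreteValuationRing_integralClosure_adicCompletion (vThreeSeven K) (wThreeSeven K)
    haveI := finite_residueField_integralClosure_adicCompletion (vThreeSeven K) (wThreeSeven K)
    haveI : IsFractionRing (integralClosure ((vThreeSeven K).adicCompletionIntegers (maximalRealSubfield K))
        ((wThreeSeven K).adicCompletion K)) ((wThreeSeven K).adicCompletion K) :=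
      integralClosure.isFractionRing_of_finite_extension ((vThreeSeven K).adicCompletion (maximalRealSubfield K))
        ((wThreeSeven K).adicCompletion K)
    ∃ (u₀ : ((vThreeSeven K).adicCompletionIntegers (maximalRealSubfield K))ˣ)
      (Φ : ↥(formUnitaryGroup (J3 (algebraMap ((vThreeSeven K).adicCompletionIntegers (maximalRealSubfield K))
        ((wThreeSeven K).adicCompletion K)
        (u₀ : (vThreeSeven K).adicCompletionIntegers (maximalRealSubfield K))))) ≃*
        ↥(formUnitaryGroup (tensorGram K (vThreeSeven K) (gramToy K))))
      (ϖ' : integralClosure ((vThreeSeven K).adicCompletionIntegers (maximalRealSubfield K))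
        ((wThreeSeven K).adicCompletion K))
      (hϖ' : Irreducible ϖ')
      (hs' : star (algebraMap (integralClosure ((vThreeSeven K).adicCompletionIntegers (maximalRealSubfield K))
        ((wThreeSeven K).adicCompletion K)) ((wThreeSeven K).adicCompletion K) ϖ') =
          algebraMap (integralClosure ((vThreeSeven K).adicCompletionIntegers (maximalRealSubfield K))
            ((wThreeSeven K).adicCompletion K)) ((wThreeSeven K).adicCompletion K) ϖ'),
      (∀ g, g ∈ hyperspecialSubgroup
          (integralClosure ((vThreeSeven K).adicCompletionIntegers (maximalRealSubfield K))
            ((wThreeSeven K).adicCompletion K))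
          (J3 (algebraMap ((vThreeSeven K).adicCompletionIntegers (maximalRealSubfield K))
            ((wThreeSeven K).adicCompletion K)
            (u₀ : (vThreeSeven K).adicCompletionIntegers (maximalRealSubfield K)))) ↔
          Φ g ∈ recordHyperspecial K (vThreeSeven K) l (gramToy K)) ∧
      ∀ {V : Type uV} [AddCommGroup V] [Module k V]
        (ρ : Representation k (↥(formUnitaryGroup (tensorGram K (vThreeSeven K) (gramToy K)))) V) [ρ.IsIrreducible],
        KFinite ρ (recordHyperspecial K (vThreeSeven K) l (gramToy K)) →
        ∀ [FiniteDimensional k (invariants ρ (recordHyperspecial K (vThreeSeven K) l (gramToy K)))],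
        invariants ρ (recordHyperspecial K (vThreeSeven K) l (gramToy K)) ≠ ⊥ →
        ∃ α : k, α ≠ 0 ∧ Nonempty (ρ.Equiv (comp Φ.symm
          (inertSphericalQuot
            (hstar_of_star_eq (localConj (vThreeSeven K) (wThreeSeven K) hθ.symm (span_pair_eq_top K hy)
              (not_isSquare_of_staysPrime K (vThreeSeven K) (wThreeSeven K) hθ hy (map_vThreeSeven K))
              (complexConj K))
              (fun x => by
                rw [star_p8_eq_star K (vThreeSeven K) (wThreeSeven K) hθ hy
                  (not_isSquare_of_staysPrime K (vThreeSeven K) (wThreeSeven K) hθ hy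
                    (map_vThreeSeven K))]
                rfl))
            (algebraMap ((vThreeSeven K).adicCompletionIntegers (maximalRealSubfield K))
              ((wThreeSeven K).adicCompletion K)
              (u₀ : (vThreeSeven K).adicCompletionIntegers (maximalRealSubfield K)))
            (star_algebraMap_of_star_eq (localConj (vThreeSeven K) (wThreeSeven K) hθ.symm
              (span_pair_eq_top K hy)
              (not_isSquare_of_staysPrime K (vThreeSeven K) (wThreeSeven K) hθ hy (map_vThreeSeven K))
              (complexConj K))
              (fun x => by
                rw [star_p8_eq_star K (vThreeSeven K) (wThreeSeven K) hθ hy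
                  (not_isSquare_of_staysPrime K (vThreeSeven K) (wThreeSeven K) hθ hy
                    (map_vThreeSeven K))]
                rfl)
              (u₀ : (vThreeSeven K).adicCompletionIntegers (maximalRealSubfield K)))
            (algebraMap_unit_ne_zero (F := (vThreeSeven K).adicCompletion (maximalRealSubfield K)) u₀)
            (isInteger_algebraMap (u₀ : (vThreeSeven K).adicCompletionIntegers (maximalRealSubfield K)))
            (isInteger_algebraMap_unit_inv u₀) hϖ' hs' k (α * ((27 : k) ^ 2)⁻¹)))) :=
  exists_mulEquiv_forall_nonempty_equiv_inertSphericalQuot_record_of_staysPrime K (vThreeSeven K)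
    (wThreeSeven K) hθ hy (map_vThreeSeven K) l k 27 (absNorm_vThreeSeven_cast K k) hl
    gramToy_isHermitian isUnit_det_gramToy (notMem_badSet_gramToy _)

end Generic

section FieldOfRecord

/-- The datum equation `algebraMap θ = y ^ 2` for `(θ, y) = (−7, √−7)` on `K7 = ℚ(ζ₇)` (file 145's
`sqrtNegSeven_sq`). -/
theorem neg_seven_eq_sqrtNegSeven_sq : algebraMap (maximalRealSubfield K7) K7 (-7) = sqrtNegSeven ^ 2 := by
  rw [map_neg, map_ofNat, sqrtNegSeven_sq]

/-- `√−7` is not fixed by complex conjugation: `complexConj √−7 = −√−7` (file 145) and `√−7 ≠ 0`. -/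
theorem complexConj_sqrtNegSeven_ne : complexConj K7 sqrtNegSeven ≠ sqrtNegSeven := by
  rw [complexConj_sqrtNegSeven]
  intro h
  have h2 : (2 : K7) * sqrtNegSeven = 0 := by linear_combination -h
  rcases mul_eq_zero.mp h2 with h3 | h3
  · exact two_ne_zero h3
  · exact sqrtNegSeven_ne_zero h3

variable {r : ℕ} (l : Fin r → 𝓞 K7) (k : Type*) [Field k] [CharZero k] [IsAlgClosed k]

/-- **THE UNRAMIFIED SPECTRUM ON THE FIELD OF RECORD `K7 = ℚ(ζ₇)` AT `(3)` WITH THE EXPLICIT DATUM `(−7, √−7)`**: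
every `K_{(3)}`-spherical irreducible of `(U(1 ⊗ H₀), K_{(3)})` is `≅ (inertSphericalQuot (α · (27²)⁻¹)) ∘ Φ⁻¹` for
some `α ≠ 0`, through an explicit `Φ : U(J₃(u₀)) ≃* U(1 ⊗ H₀)` matching the hyperspecial subgroups. -/
theorem exists_mulEquiv_forall_nonempty_equiv_inertSphericalQuot_record_seven_three_K7
    (hl : Submodule.span (𝓞 (maximalRealSubfield K7)) (Set.range l) = ⊤) :
    letI := tensorStarRing K7 (vThreeSeven K7)
    letI := starRingOfQuadratic (finrank_eq_two K7 (vThreeSeven K7) (wThreeSeven K7) neg_seven_eq_sqrtNegSeven_sq complexConj_sqrtNegSeven_ne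
        (not_isSquare_of_staysPrime K7 (vThreeSeven K7) (wThreeSeven K7) neg_seven_eq_sqrtNegSeven_sq complexConj_sqrtNegSeven_ne (map_vThreeSeven K7)))
      (localConj (vThreeSeven K7) (wThreeSeven K7) neg_seven_eq_sqrtNegSeven_sq.symm (span_pair_eq_top K7 complexConj_sqrtNegSeven_ne)
        (not_isSquare_of_staysPrime K7 (vThreeSeven K7) (wThreeSeven K7) neg_seven_eq_sqrtNegSeven_sq complexConj_sqrtNegSeven_ne (map_vThreeSeven K7))
        (complexConj K7))
      (localConj_ne_one (vThreeSeven K7) (wThreeSeven K7) neg_seven_eq_sqrtNegSeven_sq.symm (span_pair_eq_top K7 complexConj_sqrtNegSeven_ne)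
        (not_isSquare_of_staysPrime K7 (vThreeSeven K7) (wThreeSeven K7) neg_seven_eq_sqrtNegSeven_sq complexConj_sqrtNegSeven_ne (map_vThreeSeven K7))
        (complexConj K7) (complexConj_apply_eq_neg K7 neg_seven_eq_sqrtNegSeven_sq complexConj_sqrtNegSeven_ne))
    haveI := isDiscreteValuationRing_integralClosure_adicCompletion (vThreeSeven K7) (wThreeSeven K7)
    haveI := finite_residueField_integralClosure_adicCompletion (vThreeSeven K7) (wThreeSeven K7)
    haveI : IsFractionRing (integralClosure ((vThreeSeven K7).adicCompletionIntegers (maximalRealSubfield K7))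
        ((wThreeSeven K7).adicCompletion K7)) ((wThreeSeven K7).adicCompletion K7) :=
      integralClosure.isFractionRing_of_finite_extension ((vThreeSeven K7).adicCompletion (maximalRealSubfield K7))
        ((wThreeSeven K7).adicCompletion K7)
    ∃ (u₀ : ((vThreeSeven K7).adicCompletionIntegers (maximalRealSubfield K7))ˣ)
      (Φ : ↥(formUnitaryGroup (J3 (algebraMap ((vThreeSeven K7).adicCompletionIntegers (maximalRealSubfield K7))
        ((wThreeSeven K7).adicCompletion K7)
        (u₀ : (vThreeSeven K7).adicCompletionIntegers (maximalRealSubfield K7))))) ≃*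
        ↥(formUnitaryGroup (tensorGram K7 (vThreeSeven K7) (gramToy K7))))
      (ϖ' : integralClosure ((vThreeSeven K7).adicCompletionIntegers (maximalRealSubfield K7))
        ((wThreeSeven K7).adicCompletion K7))
      (hϖ' : Irreducible ϖ')
      (hs' : star (algebraMap (integralClosure ((vThreeSeven K7).adicCompletionIntegers (maximalRealSubfield K7))
        ((wThreeSeven K7).adicCompletion K7)) ((wThreeSeven K7).adicCompletion K7) ϖ') =
          algebraMap (integralClosure ((vThreeSeven K7).adicCompletionIntegers (maximalRealSubfield K7))
            ((wThreeSeven K7).adicCompletion K7)) ((wThreeSeven K7).adicCompletion K7) ϖ'),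
      (∀ g, g ∈ hyperspecialSubgroup
          (integralClosure ((vThreeSeven K7).adicCompletionIntegers (maximalRealSubfield K7))
            ((wThreeSeven K7).adicCompletion K7))
          (J3 (algebraMap ((vThreeSeven K7).adicCompletionIntegers (maximalRealSubfield K7))
            ((wThreeSeven K7).adicCompletion K7)
            (u₀ : (vThreeSeven K7).adicCompletionIntegers (maximalRealSubfield K7)))) ↔
          Φ g ∈ recordHyperspecial K7 (vThreeSeven K7) l (gramToy K7)) ∧
      ∀ {V : Type uV} [AddCommGroup V] [Module k V]
        (ρ : Representation k (↥(formUnitaryGroup (tensorGram K7 (vThreeSeven K7) (gramToy K7)))) V) [ρ.IsIrreducible],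
        KFinite ρ (recordHyperspecial K7 (vThreeSeven K7) l (gramToy K7)) →
        ∀ [FiniteDimensional k (invariants ρ (recordHyperspecial K7 (vThreeSeven K7) l (gramToy K7)))],
        invariants ρ (recordHyperspecial K7 (vThreeSeven K7) l (gramToy K7)) ≠ ⊥ →
        ∃ α : k, α ≠ 0 ∧ Nonempty (ρ.Equiv (comp Φ.symm
          (inertSphericalQuot
            (hstar_of_star_eq (localConj (vThreeSeven K7) (wThreeSeven K7) neg_seven_eq_sqrtNegSeven_sq.symm (span_pair_eq_top K7 complexConj_sqrtNegSeven_ne)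
              (not_isSquare_of_staysPrime K7 (vThreeSeven K7) (wThreeSeven K7) neg_seven_eq_sqrtNegSeven_sq complexConj_sqrtNegSeven_ne (map_vThreeSeven K7))
              (complexConj K7))
              (fun x => by
                rw [star_p8_eq_star K7 (vThreeSeven K7) (wThreeSeven K7) neg_seven_eq_sqrtNegSeven_sq complexConj_sqrtNegSeven_ne
                  (not_isSquare_of_staysPrime K7 (vThreeSeven K7) (wThreeSeven K7) neg_seven_eq_sqrtNegSeven_sq complexConj_sqrtNegSeven_ne
                    (map_vThreeSeven K7))]
                rfl))
            (algebraMap ((vThreeSeven K7).adicCompletionIntegers (maximalRealSubfield K7))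
              ((wThreeSeven K7).adicCompletion K7)
              (u₀ : (vThreeSeven K7).adicCompletionIntegers (maximalRealSubfield K7)))
            (star_algebraMap_of_star_eq (localConj (vThreeSeven K7) (wThreeSeven K7) neg_seven_eq_sqrtNegSeven_sq.symm
              (span_pair_eq_top K7 complexConj_sqrtNegSeven_ne)
              (not_isSquare_of_staysPrime K7 (vThreeSeven K7) (wThreeSeven K7) neg_seven_eq_sqrtNegSeven_sq complexConj_sqrtNegSeven_ne (map_vThreeSeven K7))
              (complexConj K7))
              (fun x => by
                rw [star_p8_eq_star K7 (vThreeSeven K7) (wThreeSeven K7) neg_seven_eq_sqrtNegSeven_sq complexConj_sqrtNegSeven_ne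
                  (not_isSquare_of_staysPrime K7 (vThreeSeven K7) (wThreeSeven K7) neg_seven_eq_sqrtNegSeven_sq complexConj_sqrtNegSeven_ne
                    (map_vThreeSeven K7))]
                rfl)
              (u₀ : (vThreeSeven K7).adicCompletionIntegers (maximalRealSubfield K7)))
            (algebraMap_unit_ne_zero (F := (vThreeSeven K7).adicCompletion (maximalRealSubfield K7)) u₀)
            (isInteger_algebraMap (u₀ : (vThreeSeven K7).adicCompletionIntegers (maximalRealSubfield K7)))
            (isInteger_algebraMap_unit_inv u₀) hϖ' hs' k (α * ((27 : k) ^ 2)⁻¹)))) :=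
  exists_mulEquiv_forall_nonempty_equiv_inertSphericalQuot_record_seven_three K7 neg_seven_eq_sqrtNegSeven_sq
    complexConj_sqrtNegSeven_ne l k hl

/-- **With the generators supplied** (file 235's `exists_fin_span_eq_top`): the whole hypothesis set of file 344's
statement is inhabited on the field of record `ℚ(ζ₇)` at `3` with the explicit datum `(−7, √−7)`. -/
theorem exists_generators_and_mulEquiv_forall_nonempty_equiv_inertSphericalQuot_record_seven_three_K7 :
    ∃ (r : ℕ) (l : Fin r → 𝓞 K7), Submodule.span (𝓞 (maximalRealSubfield K7)) (Set.range l) = ⊤ ∧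
      (letI := tensorStarRing K7 (vThreeSeven K7)
      letI := starRingOfQuadratic (finrank_eq_two K7 (vThreeSeven K7) (wThreeSeven K7) neg_seven_eq_sqrtNegSeven_sq complexConj_sqrtNegSeven_ne
          (not_isSquare_of_staysPrime K7 (vThreeSeven K7) (wThreeSeven K7) neg_seven_eq_sqrtNegSeven_sq complexConj_sqrtNegSeven_ne (map_vThreeSeven K7)))
        (localConj (vThreeSeven K7) (wThreeSeven K7) neg_seven_eq_sqrtNegSeven_sq.symm (span_pair_eq_top K7 complexConj_sqrtNegSeven_ne)
          (not_isSquare_of_staysPrime K7 (vThreeSeven K7) (wThreeSeven K7) neg_seven_eq_sqrtNegSeven_sq complexConj_sqrtNegSeven_ne (map_vThreeSeven K7))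
          (complexConj K7))
        (localConj_ne_one (vThreeSeven K7) (wThreeSeven K7) neg_seven_eq_sqrtNegSeven_sq.symm (span_pair_eq_top K7 complexConj_sqrtNegSeven_ne)
          (not_isSquare_of_staysPrime K7 (vThreeSeven K7) (wThreeSeven K7) neg_seven_eq_sqrtNegSeven_sq complexConj_sqrtNegSeven_ne (map_vThreeSeven K7))
          (complexConj K7) (complexConj_apply_eq_neg K7 neg_seven_eq_sqrtNegSeven_sq complexConj_sqrtNegSeven_ne))
      haveI := isDiscreteValuationRing_integralClosure_adicCompletion (vThreeSeven K7) (wThreeSeven K7)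
      haveI := finite_residueField_integralClosure_adicCompletion (vThreeSeven K7) (wThreeSeven K7)
      haveI : IsFractionRing (integralClosure ((vThreeSeven K7).adicCompletionIntegers (maximalRealSubfield K7))
          ((wThreeSeven K7).adicCompletion K7)) ((wThreeSeven K7).adicCompletion K7) :=
        integralClosure.isFractionRing_of_finite_extension ((vThreeSeven K7).adicCompletion (maximalRealSubfield K7))
          ((wThreeSeven K7).adicCompletion K7)
      ∃ (u₀ : ((vThreeSeven K7).adicCompletionIntegers (maximalRealSubfield K7))ˣ)
        (Φ : ↥(formUnitaryGroup (J3 (algebraMap ((vThreeSeven K7).adicCompletionIntegers (maximalRealSubfield K7))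
          ((wThreeSeven K7).adicCompletion K7)
          (u₀ : (vThreeSeven K7).adicCompletionIntegers (maximalRealSubfield K7))))) ≃*
          ↥(formUnitaryGroup (tensorGram K7 (vThreeSeven K7) (gramToy K7))))
        (ϖ' : integralClosure ((vThreeSeven K7).adicCompletionIntegers (maximalRealSubfield K7))
          ((wThreeSeven K7).adicCompletion K7))
        (hϖ' : Irreducible ϖ')
        (hs' : star (algebraMap (integralClosure ((vThreeSeven K7).adicCompletionIntegers (maximalRealSubfield K7))
          ((wThreeSeven K7).adicCompletion K7)) ((wThreeSeven K7).adicCompletion K7) ϖ') =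
            algebraMap (integralClosure ((vThreeSeven K7).adicCompletionIntegers (maximalRealSubfield K7))
              ((wThreeSeven K7).adicCompletion K7)) ((wThreeSeven K7).adicCompletion K7) ϖ'),
        (∀ g, g ∈ hyperspecialSubgroup
            (integralClosure ((vThreeSeven K7).adicCompletionIntegers (maximalRealSubfield K7))
              ((wThreeSeven K7).adicCompletion K7))
            (J3 (algebraMap ((vThreeSeven K7).adicCompletionIntegers (maximalRealSubfield K7))
              ((wThreeSeven K7).adicCompletion K7)
              (u₀ : (vThreeSeven K7).adicCompletionIntegers (maximalRealSubfield K7)))) ↔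
            Φ g ∈ recordHyperspecial K7 (vThreeSeven K7) l (gramToy K7)) ∧
        ∀ {V : Type uV} [AddCommGroup V] [Module k V]
          (ρ : Representation k (↥(formUnitaryGroup (tensorGram K7 (vThreeSeven K7) (gramToy K7)))) V) [ρ.IsIrreducible],
          KFinite ρ (recordHyperspecial K7 (vThreeSeven K7) l (gramToy K7)) →
          ∀ [FiniteDimensional k (invariants ρ (recordHyperspecial K7 (vThreeSeven K7) l (gramToy K7)))],
          invariants ρ (recordHyperspecial K7 (vThreeSeven K7) l (gramToy K7)) ≠ ⊥ →
          ∃ α : k, α ≠ 0 ∧ Nonempty (ρ.Equiv (comp Φ.symm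
            (inertSphericalQuot
              (hstar_of_star_eq (localConj (vThreeSeven K7) (wThreeSeven K7) neg_seven_eq_sqrtNegSeven_sq.symm (span_pair_eq_top K7 complexConj_sqrtNegSeven_ne)
                (not_isSquare_of_staysPrime K7 (vThreeSeven K7) (wThreeSeven K7) neg_seven_eq_sqrtNegSeven_sq complexConj_sqrtNegSeven_ne (map_vThreeSeven K7))
                (complexConj K7))
                (fun x => by
                  rw [star_p8_eq_star K7 (vThreeSeven K7) (wThreeSeven K7) neg_seven_eq_sqrtNegSeven_sq complexConj_sqrtNegSeven_ne
                    (not_isSquare_of_staysPrime K7 (vThreeSeven K7) (wThreeSeven K7) neg_seven_eq_sqrtNegSeven_sq complexConj_sqrtNegSeven_ne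
                      (map_vThreeSeven K7))]
                  rfl))
              (algebraMap ((vThreeSeven K7).adicCompletionIntegers (maximalRealSubfield K7))
                ((wThreeSeven K7).adicCompletion K7)
                (u₀ : (vThreeSeven K7).adicCompletionIntegers (maximalRealSubfield K7)))
              (star_algebraMap_of_star_eq (localConj (vThreeSeven K7) (wThreeSeven K7) neg_seven_eq_sqrtNegSeven_sq.symm
                (span_pair_eq_top K7 complexConj_sqrtNegSeven_ne)
                (not_isSquare_of_staysPrime K7 (vThreeSeven K7) (wThreeSeven K7) neg_seven_eq_sqrtNegSeven_sq complexConj_sqrtNegSeven_ne (map_vThreeSeven K7))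
                (complexConj K7))
                (fun x => by
                  rw [star_p8_eq_star K7 (vThreeSeven K7) (wThreeSeven K7) neg_seven_eq_sqrtNegSeven_sq complexConj_sqrtNegSeven_ne
                    (not_isSquare_of_staysPrime K7 (vThreeSeven K7) (wThreeSeven K7) neg_seven_eq_sqrtNegSeven_sq complexConj_sqrtNegSeven_ne
                      (map_vThreeSeven K7))]
                  rfl)
                (u₀ : (vThreeSeven K7).adicCompletionIntegers (maximalRealSubfield K7)))
              (algebraMap_unit_ne_zero (F := (vThreeSeven K7).adicCompletion (maximalRealSubfield K7)) u₀)
              (isInteger_algebraMap (u₀ : (vThreeSeven K7).adicCompletionIntegers (maximalRealSubfield K7)))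
              (isInteger_algebraMap_unit_inv u₀) hϖ' hs' k (α * ((27 : k) ^ 2)⁻¹))))) :=
  (exists_fin_span_eq_top K7).elim fun r h => h.elim fun l hl =>
    ⟨r, l, hl, exists_mulEquiv_forall_nonempty_equiv_inertSphericalQuot_record_seven_three_K7 l k hl⟩

end FieldOfRecord

end Summit.Ventures.HodgeRepro2.T5RecordSphericalSpectrumSevenToy
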